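import Literature.Analysis.Distribution.FourierLaplaceHolomorphic
import Literature.Analysis.Distribution.FourierLaplaceKernelContinuity
import Literature.Analysis.FunctionSpaces.SchwartzExchange
import Literature.Analysis.FunctionSpaces.SchwartzParametric
import HarnessLib

/-!
# Boundary values of the Fourier–Laplace transform; proof of `fourierLaplace_coneSupport`

Topic `Literature/Analysis/Distribution`. Last brick: the distributional boundary value of
`F = fourierLaplaceFun T S` along the rays `x + ity`, `y` in the open cone `interior S⁻`,
`t → 0⁺`, is `T` (Streater–Wightman (1964), Thm. 2-9: "`ℒ(T)` converges in `𝒮'_ξ` to `ℱ(T)`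
as `η → 0`"; Hörmander (1990), Remark after Thm. 7.4.3), and the assembly of the named fact
`fourierLaplace_coneSupport` (`FourierLaplaceCone`; Hörmander Thm. 7.4.2) from the bricks
`SmoothCutoff`, `ExpLinearEstimates`, `ConeCutoffEstimates`, `FourierLaplaceTransform`,
`FourierLaplaceHolomorphic`, `FourierLaplaceKernelContinuity`:

* `integral_fourierLaplaceFun_rayPoint_mul`: for `t > 0`,
  `∫ F(x + ity) φ(x) dx = u(χ_S e^{2πt⟨y,·⟩} · 𝓕φ)` — the tempered distribution `u` commutes with
  the `x`-integral of the continuous, polynomially growing family of kernels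
  (`SchwartzMap.apply_eq_integral_of_forall_apply_eq_integral`, `SchwartzExchange`), and
  `∫ φ(x) e^{−2πi⟨x,ξ⟩} dx = 𝓕φ(ξ)`;
* `tendsto_integral_fourierLaplaceFun_rayPoint_mul`: as `t → 0⁺` this tends to
  `u(χ_S 𝓕φ) = u(𝓕φ) = T(φ)` (`χ_S = 1` near `S ⊇ supp u`; the seminorms of
  `χ_S (e^{2πt⟨y,·⟩} − 1) 𝓕φ` are `O(t)`, `norm_iteratedFDeriv_cutoff_sub_one_mul_le`);
* `fourierLaplace_coneSupport_holds`: **the named fact `fourierLaplace_coneSupport ι` holds**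
  (the witness is `fourierLaplaceFun T S`; holomorphy and polynomial bounds from
  `FourierLaplaceHolomorphic`). The closedness/convexity/cone hypotheses of the fact are not
  used by the construction (they only serve to identify `interior S⁻` with Hörmander's `Γ°`).

## References

* R. F. Streater, A. S. Wightman, *PCT, Spin and Statistics, and All That*, §2-3, Thm. 2-9
  (pdf p. 56 of the 2000 printing). [StreaterWightman1964]
* L. Hörmander, *The Analysis of Linear Partial Differential Operators I*, 2nd ed., §7.4,
  Thm. 7.4.2 and the Remark after Thm. 7.4.3 (pdf pp. 161–163). [HormanderALPDO1]
-/

noncomputable section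

open Set Filter Metric SchwartzMap MeasureTheory
open _root_.Complex (exp I)
open scoped ContDiff Topology RealInnerProductSpace SchwartzMap FourierTransform

namespace Literature.Analysis.Distribution

variable {ι : Type*} [Fintype ι]

/-! ### The kernel along a ray factors through the Fourier phase -/

/-- Along the ray `x + ity` the kernel is the kernel at `ity` times Mathlib's Fourier phase
`e^{−2πi⟨x, ξ⟩}`. [folklore] -/
theorem laplaceKernel_rayPoint_apply (S : Set (EuclideanSpace ℝ ι)) {y : EuclideanSpace ℝ ι}
    (hy : y ∈ interior (polarCone S)) {t : ℝ} (ht : 0 < t) (x ξ : EuclideanSpace ℝ ι) :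
    laplaceKernel S (rayPoint x y t) ξ =
      laplaceKernel S (rayPoint 0 y t) ξ * exp (((-2 * Real.pi * ⟪x, ξ⟫ : ℝ) : ℂ) * I) := by
  have hty : t • y ∈ interior (polarCone S) := smul_mem_interior_polarCone hy ht
  have hx : imVec (rayPoint x y t) ∈ interior (polarCone S) := by rwa [imVec_rayPoint]
  have h0 : imVec (rayPoint 0 y t) ∈ interior (polarCone S) := by rwa [imVec_rayPoint]
  rw [laplaceKernel_apply hx, laplaceKernel_apply h0, expForm_rayPoint_apply,
    expForm_rayPoint_apply, inner_zero_left, mul_zero, Complex.ofReal_zero, zero_mul, zero_add,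
    Complex.exp_add]
  ring

/-- The `x`-integral of the kernels against `φ` is the kernel at `ity` times `𝓕φ`:
`∫ φ(x) χ(ξ) e^{−2πi⟨x+ity, ξ⟩} dx = χ(ξ) e^{2πt⟨y,ξ⟩} 𝓕φ(ξ)`. [folklore] -/
theorem integral_mul_laplaceKernel_rayPoint (S : Set (EuclideanSpace ℝ ι)) {y : EuclideanSpace ℝ ι}
    (hy : y ∈ interior (polarCone S)) {t : ℝ} (ht : 0 < t) (φ : 𝓢(EuclideanSpace ℝ ι, ℂ))
    (ξ : EuclideanSpace ℝ ι) :
    ∫ x, φ x * laplaceKernel S (rayPoint x y t) ξ = laplaceKernel S (rayPoint 0 y t) ξ * 𝓕 φ ξ := by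
  have e : ∀ x : EuclideanSpace ℝ ι, φ x * laplaceKernel S (rayPoint x y t) ξ =
      laplaceKernel S (rayPoint 0 y t) ξ *
        (exp (((-2 * Real.pi * ⟪x, ξ⟫ : ℝ) : ℂ) * I) • φ x) := fun x => by
    rw [laplaceKernel_rayPoint_apply S hy ht x ξ, smul_eq_mul]; ring
  simp_rw [e]
  rw [integral_const_mul, SchwartzMap.fourier_coe, Real.fourier_eq']

/-! ### Exchange of the tempered distribution with the `x`-integral -/

/-- **The boundary-value pairing at height `t > 0`**:
`∫ F(x + ity) φ(x) dx = u(laplaceKernel S (ity) · 𝓕φ)` (tempered distributions commute with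
Schwartz-valued integrals; Streater–Wightman (1964), proof of Thm. 2-9).
[cite: StreaterWightman1964, Thm 2-9] -/
theorem integral_fourierLaplaceFun_rayPoint_mul (T : 𝓢(EuclideanSpace ℝ ι, ℂ) →L[ℂ] ℂ)
    (S : Set (EuclideanSpace ℝ ι)) {y : EuclideanSpace ℝ ι} (hy : y ∈ interior (polarCone S))
    {t : ℝ} (ht : 0 < t) (φ : 𝓢(EuclideanSpace ℝ ι, ℂ)) :
    ∫ x, fourierLaplaceFun T S (rayPoint x y t) * φ x =
      fourierInvDual T (SchwartzMap.pairing (ContinuousLinearMap.mul ℂ ℂ)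
        (laplaceKernel S (rayPoint 0 y t)) (𝓕 φ)) := by
  have hex := SchwartzMap.apply_eq_integral_of_forall_apply_eq_integral
    (μ := (volume : Measure (EuclideanSpace ℝ ι))) (fourierInvDual T)
    (fun x => laplaceKernel S (rayPoint x y t)) (continuous_laplaceKernel_rayPoint S hy ht)
    (fun k n => by
      obtain ⟨C, hC⟩ := exists_seminorm_laplaceKernel_rayPoint_le S hy ht k n
      exact ⟨C, n, hC⟩)
    φ φ.continuous (fun N => φ.integrable_one_add_norm_pow_mul N)
    (SchwartzMap.pairing (ContinuousLinearMap.mul ℂ ℂ) (laplaceKernel S (rayPoint 0 y t)) (𝓕 φ))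
    (fun ξ => by
      rw [SchwartzMap.pairing_apply_apply, ContinuousLinearMap.mul_apply',
        integral_mul_laplaceKernel_rayPoint S hy ht φ ξ])
  rw [hex]
  refine integral_congr_ae (Eventually.of_forall fun x => ?_)
  simp only [fourierLaplaceFun_apply, mul_comm]

/-! ### The limit `t → 0⁺` -/

/-- The complexified cutoff has temperate growth. [folklore] -/
theorem hasTemperateGrowth_coneCutoff (S : Set (EuclideanSpace ℝ ι)) :
    Function.HasTemperateGrowth fun ξ => (coneCutoff S ξ : ℂ) := by
  refine ⟨contDiff_ofReal_comp (contDiff_coneCutoff S), fun n => ⟨0, coneCutoffBound S n, fun x => ?_⟩⟩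
  rw [norm_iteratedFDeriv_ofReal_comp (contDiff_coneCutoff S), pow_zero, mul_one]
  exact norm_iteratedFDeriv_coneCutoff_le S le_rfl x

/-- **`u(χ_S 𝓕φ) = T(φ)`**: `χ_S = 1` on the neighbourhood `thickening 1 S` of `S ⊇ supp u`, so
`u((χ_S − 1) 𝓕φ) = 0`, and `u(𝓕φ) = T(φ)`. [folklore] -/
theorem fourierInvDual_coneCutoff_smul_fourier {T : 𝓢(EuclideanSpace ℝ ι, ℂ) →L[ℂ] ℂ}
    {S : Set (EuclideanSpace ℝ ι)}
    (hT : ∀ φ : 𝓢(EuclideanSpace ℝ ι, ℂ),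
      Disjoint (tsupport (⇑(SchwartzMap.fourierTransformCLM ℂ φ))) S → T φ = 0)
    (φ : 𝓢(EuclideanSpace ℝ ι, ℂ)) :
    fourierInvDual T (SchwartzMap.smulLeftCLM ℂ (fun ξ => (coneCutoff S ξ : ℂ)) (𝓕 φ)) = T φ := by
  set G := SchwartzMap.smulLeftCLM ℂ (fun ξ => (coneCutoff S ξ : ℂ)) (𝓕 φ) - 𝓕 φ with hG
  have hG0 : ∀ ξ ∈ thickening 1 S, G ξ = 0 := fun ξ hξ => by
    rw [hG, sub_apply, SchwartzMap.smulLeftCLM_apply_apply (hasTemperateGrowth_coneCutoff S),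
      coneCutoff_eq_one hξ, Complex.ofReal_one, one_smul, sub_self]
  have hsupp : tsupport (⇑G) ⊆ (thickening 1 S)ᶜ := by
    refine closure_minimal (fun ξ hξ => ?_) isOpen_thickening.isClosed_compl
    exact fun h => hξ (hG0 ξ h)
  have hdisj : Disjoint (tsupport (⇑G)) S :=
    Set.disjoint_of_subset_left hsupp
      (disjoint_compl_left.mono_right (self_subset_thickening one_pos S))
  have h0 : fourierInvDual T G = 0 := fourierInvDual_eq_zero hT hdisj
  have e : SchwartzMap.smulLeftCLM ℂ (fun ξ => (coneCutoff S ξ : ℂ)) (𝓕 φ) = G + 𝓕 φ := by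
    rw [hG, sub_add_cancel]
  rw [e, map_add, h0, zero_add, fourierInvDual_fourier]

/-- **The boundary value of the Fourier–Laplace transform is `T`** (Streater–Wightman (1964),
Thm. 2-9; Hörmander (1990), Remark after Thm. 7.4.3): for `y` in the open cone,
`∫ F(x + ity) φ(x) dx → T(φ)` as `t → 0⁺`. [cite: StreaterWightman1964, Thm 2-9] -/
theorem tendsto_integral_fourierLaplaceFun_rayPoint_mul (T : 𝓢(EuclideanSpace ℝ ι, ℂ) →L[ℂ] ℂ)
    (S : Set (EuclideanSpace ℝ ι))
    (hT : ∀ φ : 𝓢(EuclideanSpace ℝ ι, ℂ),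
      Disjoint (tsupport (⇑(SchwartzMap.fourierTransformCLM ℂ φ))) S → T φ = 0)
    {y : EuclideanSpace ℝ ι} (hy : y ∈ interior (polarCone S)) (φ : 𝓢(EuclideanSpace ℝ ι, ℂ)) :
    Tendsto (fun t : ℝ => ∫ x, fourierLaplaceFun T S (rayPoint x y t) * φ x)
      (𝓝[>] 0) (𝓝 (T φ)) := by
  -- `u` is bounded by finitely many seminorms
  obtain ⟨k₀, n₀, Cu, hCu, hu⟩ := exists_bound_seminorm_clm (fourierInvDual T)
  -- geometry at `y`: `⟪y, ξ⟫ ≤ 3(r + R)` on the support of the cutoff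
  obtain ⟨r, R, hr, hR, -, hgeo⟩ := exists_forall_inner_le_of_subset_interior_polarCone
    (S := S) isCompact_singleton (singleton_subset_iff.2 hy)
  set A' : ℝ := 2 * Real.pi * (3 * (r + R)) with hA'
  have hA'0 : 0 ≤ A' := by positivity
  -- constants
  set κ : ℝ := 2 * Real.pi * Fintype.card ι with hκ
  have hκ0 : 0 ≤ κ := by positivity
  set ψ : 𝓢(EuclideanSpace ℝ ι, ℂ) := 𝓕 φ with hψ
  set K₀ : 𝓢(EuclideanSpace ℝ ι, ℂ) := SchwartzMap.smulLeftCLM ℂ (fun ξ => (coneCutoff S ξ : ℂ)) ψ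
    with hK₀
  have hK₀u : fourierInvDual T K₀ = T φ := fourierInvDual_coneCutoff_smul_fourier hT φ
  -- the seminorm bound constants
  set E : ℕ × ℕ → ℝ := fun m => 4 ^ m.2 * coneCutoffBound S m.2 * (κ * ‖y‖) * Real.exp A' *
    (2 ^ (m.1 + 1) * (Finset.Iic (m.1 + 1, m.2)).sup
      (fun m' => SchwartzMap.seminorm ℂ m'.1 m'.2) ψ) with hE
  have hE0 : ∀ m, 0 ≤ E m := fun m => by
    have := coneCutoffBound_nonneg S m.2
    positivity
  set t₁ : ℝ := min 1 (1 / (κ * ‖y‖ + 1)) with ht₁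
  have ht₁0 : 0 < t₁ := by positivity
  -- the key estimate for `0 < t ≤ t₁`
  have hkey : ∀ t : ℝ, 0 < t → t ≤ t₁ →
      ‖(∫ x, fourierLaplaceFun T S (rayPoint x y t) * φ x) - T φ‖ ≤
        Cu * (∑ m ∈ Finset.Iic (k₀, n₀), E m) * t := by
    intro t ht htt
    have ht1 : t ≤ 1 := htt.trans (min_le_left _ _)
    have hty : t • y ∈ interior (polarCone S) := smul_mem_interior_polarCone hy ht
    have h0 : imVec (rayPoint 0 y t) ∈ interior (polarCone S) := by rwa [imVec_rayPoint]
    set ℓ' := expForm (rayPoint (0 : EuclideanSpace ℝ ι) y t) with hℓ'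
    -- `‖ℓ'‖ ≤ κ t ‖y‖ ≤ 1`
    have hℓ'n : ‖ℓ'‖ ≤ κ * (t * ‖y‖) := by
      refine (norm_expForm_le _).trans ?_
      have h := norm_rayPoint_le (0 : EuclideanSpace ℝ ι) y t
      rw [norm_zero, zero_add, abs_of_pos ht] at h
      exact mul_le_mul_of_nonneg_left h hκ0
    have hℓ'1 : ‖ℓ'‖ ≤ 1 := by
      have h2 : t ≤ 1 / (κ * ‖y‖ + 1) := htt.trans (min_le_right _ _)
      rw [le_div_iff₀ (by positivity)] at h2
      nlinarith [norm_nonneg y]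
    -- `Re ℓ' ≤ A'` on the support of the cutoff
    have hℓ're : ∀ ξ ∈ tsupport (coneCutoff S), (ℓ' ξ).re ≤ A' := by
      intro ξ hξ
      rw [hℓ', re_expForm_apply, imVec_rayPoint, real_inner_smul_left]
      have h1 := hgeo y (mem_singleton _) ξ (tsupport_coneCutoff_subset S hξ)
      have h2 : ⟪y, ξ⟫ ≤ 3 * (r + R) := by nlinarith [norm_nonneg ξ]
      have h3 : t * ⟪y, ξ⟫ ≤ 1 * (3 * (r + R)) := by
        rcases le_or_gt 0 ⟪y, ξ⟫ with h | h
        · exact mul_le_mul ht1 h2 h zero_le_one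
        · nlinarith
      nlinarith [Real.pi_pos]
    -- the difference `K_t − K₀` and its pointwise form
    set Kt : 𝓢(EuclideanSpace ℝ ι, ℂ) := SchwartzMap.pairing (ContinuousLinearMap.mul ℂ ℂ)
      (laplaceKernel S (rayPoint 0 y t)) ψ with hKt
    have hfun : ⇑(Kt - K₀) = fun ξ => (coneCutoff S ξ : ℂ) * (exp (ℓ' ξ) - 1) * ψ ξ := by
      funext ξ
      rw [sub_apply, hKt, SchwartzMap.pairing_apply_apply, ContinuousLinearMap.mul_apply', hK₀,
        SchwartzMap.smulLeftCLM_apply_apply (hasTemperateGrowth_coneCutoff S),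
        laplaceKernel_apply h0, smul_eq_mul]
      ring
    -- seminorm bound `O(t)`
    have hsemi : ∀ m : ℕ × ℕ, SchwartzMap.seminorm ℂ m.1 m.2 (Kt - K₀) ≤ E m * t := by
      intro m
      refine SchwartzMap.seminorm_le_bound ℂ m.1 m.2 _ (mul_nonneg (hE0 m) ht.le) fun ξ => ?_
      rw [hfun]
      have hBψ : ∀ i ≤ m.2, ‖iteratedFDeriv ℝ i ψ ξ‖ ≤ 2 ^ (m.1 + 1) *
          (Finset.Iic (m.1 + 1, m.2)).sup (fun m' => SchwartzMap.seminorm ℂ m'.1 m'.2) ψ /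
            (1 + ‖ξ‖) ^ (m.1 + 1) := by
        intro i hi
        have h := one_add_le_sup_seminorm_apply (𝕜 := ℂ) (m := (m.1 + 1, m.2)) le_rfl hi ψ ξ
        rw [le_div_iff₀ (by positivity)]
        calc ‖iteratedFDeriv ℝ i ψ ξ‖ * (1 + ‖ξ‖) ^ (m.1 + 1)
            = (1 + ‖ξ‖) ^ (m.1 + 1) * ‖iteratedFDeriv ℝ i ψ ξ‖ := mul_comm _ _
          _ ≤ _ := h
      have h := norm_iteratedFDeriv_cutoff_sub_one_mul_le (contDiff_coneCutoff S)
        (fun i hi x => norm_iteratedFDeriv_coneCutoff_le S hi x) ℓ' hℓ're hℓ'1 (ψ.smooth ⊤) ξ hBψ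
      have hsup0 : 0 ≤ (Finset.Iic (m.1 + 1, m.2)).sup
          (fun m' => SchwartzMap.seminorm ℂ m'.1 m'.2) ψ := apply_nonneg _ _
      have hCn := coneCutoffBound_nonneg S m.2
      have hξ1 : ‖ξ‖ ^ m.1 * (1 + ‖ξ‖) ≤ (1 + ‖ξ‖) ^ (m.1 + 1) := by
        rw [pow_succ]
        gcongr
        linarith [norm_nonneg ξ]
      calc ‖ξ‖ ^ m.1 * ‖iteratedFDeriv ℝ m.2
            (fun ξ => (coneCutoff S ξ : ℂ) * (exp (ℓ' ξ) - 1) * ψ ξ) ξ‖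
          ≤ ‖ξ‖ ^ m.1 * (4 ^ m.2 * coneCutoffBound S m.2 * ‖ℓ'‖ * (1 + ‖ξ‖) *
              Real.exp (max A' 0) * (2 ^ (m.1 + 1) *
                (Finset.Iic (m.1 + 1, m.2)).sup (fun m' => SchwartzMap.seminorm ℂ m'.1 m'.2) ψ /
                  (1 + ‖ξ‖) ^ (m.1 + 1))) := mul_le_mul_of_nonneg_left h (by positivity)
        _ = 4 ^ m.2 * coneCutoffBound S m.2 * ‖ℓ'‖ * Real.exp (max A' 0) * (2 ^ (m.1 + 1) *
              (Finset.Iic (m.1 + 1, m.2)).sup (fun m' => SchwartzMap.seminorm ℂ m'.1 m'.2) ψ) *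
              (‖ξ‖ ^ m.1 * (1 + ‖ξ‖) / (1 + ‖ξ‖) ^ (m.1 + 1)) := by ring
        _ ≤ 4 ^ m.2 * coneCutoffBound S m.2 * ‖ℓ'‖ * Real.exp (max A' 0) * (2 ^ (m.1 + 1) *
              (Finset.Iic (m.1 + 1, m.2)).sup (fun m' => SchwartzMap.seminorm ℂ m'.1 m'.2) ψ) * 1 :=
            mul_le_mul_of_nonneg_left ((div_le_one (by positivity)).2 hξ1) (by positivity)
        _ ≤ 4 ^ m.2 * coneCutoffBound S m.2 * (κ * (t * ‖y‖)) * Real.exp (max A' 0) *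
              (2 ^ (m.1 + 1) * (Finset.Iic (m.1 + 1, m.2)).sup
                (fun m' => SchwartzMap.seminorm ℂ m'.1 m'.2) ψ) * 1 := by
            gcongr
        _ = E m * t := by
            simp only [hE, max_eq_left hA'0]
            ring
    -- conclusion of the key estimate
    rw [integral_fourierLaplaceFun_rayPoint_mul T S hy ht φ, ← hK₀u, ← map_sub]
    refine (hu _).trans ?_
    rw [mul_assoc]
    refine mul_le_mul_of_nonneg_left ?_ hCu
    refine Seminorm.finset_sup_apply_le (mul_nonneg (Finset.sum_nonneg fun m _ => hE0 m) ht.le)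
      fun m hm => ?_
    rw [schwartzSeminormFamily_apply]
    calc SchwartzMap.seminorm ℂ m.1 m.2 (Kt - K₀) ≤ E m * t := hsemi m
      _ ≤ (∑ m' ∈ Finset.Iic (k₀, n₀), E m') * t := by
          gcongr
          exact Finset.single_le_sum (fun m' _ => hE0 m') hm
  -- the limit
  set C : ℝ := Cu * ∑ m ∈ Finset.Iic (k₀, n₀), E m with hC
  have hC0 : 0 ≤ C := mul_nonneg hCu (Finset.sum_nonneg fun m _ => hE0 m)
  rw [Metric.tendsto_nhdsWithin_nhds]
  intro ε hε
  refine ⟨min t₁ (ε / (C + 1)), lt_min ht₁0 (by positivity), fun t ht hdist => ?_⟩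
  rw [mem_Ioi] at ht
  rw [dist_zero_right, Real.norm_of_nonneg ht.le] at hdist
  rw [dist_eq_norm]
  calc ‖(∫ x, fourierLaplaceFun T S (rayPoint x y t) * φ x) - T φ‖ ≤ C * t :=
        hkey t ht (hdist.le.trans (min_le_left _ _))
    _ ≤ C * (ε / (C + 1)) := by
        gcongr
        exact hdist.le.trans (min_le_right _ _)
    _ < ε := by
        rw [mul_div_assoc', div_lt_iff₀ (by positivity)]
        nlinarith

/-! ### The named fact -/

/-- **Fourier–Laplace representation of a tempered distribution with spectrum in a cone — the
named fact `fourierLaplace_coneSupport ι` holds** (Hörmander (1990), Thm. 7.4.2 with the Remark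
after Thm. 7.4.3; Streater–Wightman (1964), Thms. 2-6 and 2-9). The witness is the
Fourier–Laplace transform `fourierLaplaceFun T S`, `F(z) = u(χ_S e^{−2πi⟨z,·⟩})`, `u = T ∘ 𝓕⁻¹`.
[cite: HormanderALPDO1, Thm 7.4.2 and Remark after Thm 7.4.3] -/
theorem fourierLaplace_coneSupport_holds : fourierLaplace_coneSupport ι := by
  intro T S _ _ _ hT
  refine ⟨fourierLaplaceFun T S, differentiableOn_fourierLaplaceFun T S,
    fun M hM hMS => exists_norm_fourierLaplaceFun_le T S hM hMS, fun y hy φ => ?_⟩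
  exact tendsto_integral_fourierLaplaceFun_rayPoint_mul T S hT hy φ

end Literature.Analysis.Distribution
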